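/-
Literature file (hubbard-downfold router front-end; hubbard-eph doped-semiconductor controls): the DEGENERATE
CARRIER GAS IN A PARABOLIC BAND — carrier density `n`, band curvature `A = ħ²/2m*` and valley multiplicity `g`
↦ Fermi wavevector, Fermi energy and density of states at the Fermi level, in three and in two dimensions,
with the exact count laws, monotonicities, scaling rules, the anti-adiabatic threshold density, and located
numerical witnesses (Kittel's `29.609`, Kittel's Cu row, Kriener et al.'s SiC:B `k_F`).
-/
import Mathlib.Analysis.SpecialFunctions.Pow.Real
import Mathlib.Analysis.Real.Pi.Bounds
import Literature.MathematicalPhysics.QuantumManyBody.SommerfeldCoefficient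
import HarnessLib

/-!
# The degenerate carrier gas in a parabolic band (3D and 2D)

Doped covalent semiconductors and doped band insulators on the validation set of this programme's material
oracle (B-doped diamond / SiC / Si, Nb-doped SrTiO₃, Tl/Na-doped PbTe, the intercalated nitride chlorides
AₓZrNCl / AₓHfNCl) are typed by a CARRIER DENSITY `n` in an otherwise empty (or full) band. Every printed
first estimate of their electronic scale is the free-electron («parabolic band») dictionary of Kittel's
chapter on the free electron Fermi gas: with `N` electrons (both spins) in volume `V`,
`(V/3π²) k_F³ = N` (Eq. (19)), `k_F = (3π² N/V)^{1/3}` (Eq. (20)), `ε_F = (ħ²/2m) k_F²` (Eq. (18), (21)) and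
`𝔇(ε_F) = 3N/(2ε_F)` (Eq. (25)); in two dimensions «the density of orbitals of a free electron gas … is
independent of energy: `𝔇(ε) = m/πħ²` per unit area» (ch. 7, Problem 4). Semiconductor physics applies the
same count to each of `g` equivalent valleys (pockets) holding `n/g` carriers each, with the band mass `m*`
in place of `m`; we carry `A = ħ²/(2m*)` (energy × length²) as a free positive parameter so that every
statement below is unit-free and exact.

Definitions (`n` = carriers per volume, resp. `n₂` per area, counting both spins; `g > 0` valleys; `A > 0`):
* `kF3 n g = (3π² n/g)^{1/3}`, `eF3 A n g = A·kF3²`, `dos3 A n g = g·kF3/(2π²A)` (states per energy per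
  volume, both spins, all valleys);
* `kF2 n₂ g = (2π n₂/g)^{1/2}`, `eF2 A n₂ g = 2πA n₂/g`, `dos2 A g = g/(2πA)` (per area).

Proved here (all exact algebra on the printed formulas):
* COUNT LAWS `g·kF3³/(3π²) = n` [Kittel (19) per valley], `dos3·eF3 = (3/2)·n` [Kittel (25)],
  `g·kF2²/(2π) = n₂`, `eF2 = A·kF2²`, `dos2·eF2 = n₂` (the 2D density of states carries no `n₂`: the located
  «N(E_F) nearly constant in the small carrier density regime» of the nitride chlorides is this identity);
* MONOTONICITY / BOX RULES: `kF3`, `eF3`, `dos3` strictly increasing in `n`; `kF3`, `eF3` strictly decreasing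
  and `dos3` strictly increasing in the valley number `g`; `eF3` increasing and `dos3` decreasing in `A`
  (a heavier band mass raises the density of states and lowers the Fermi energy at fixed `n`); hence corner
  rules for a box in `n`;
* SCALING: `kF3 (c³n) g = c·kF3 n g`, so `×8` in density is `×2` in `k_F` and `×4` in `ε_F`;
* THE ANTI-ADIABATIC THRESHOLD: for a phonon (or any boson) energy `ω > 0` the density
  `nStar A ω g = g(ω/A)^{3/2}/(3π²)` is the unique one with `ε_F = ω`, and `ε_F < ω ↔ n < nStar` — the exact
  content of «outside the Migdal regime for all dopings below …» statements about dilute superconductors;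
* DOPANT COUNT ↔ CARRIER DENSITY (§7): `carrierDensity3 x Z V = xZ/V` and its inverse `dopantPerFU`, the 2D
  analogue, `ε_F(2D)` linear in the dopant count `x`; the SINGLE-SPHERE SOMMERFELD MASS
  `singleSphereMass γ_vol k_F = 3ħ²γ_vol/(k_B²k_F)` (Lin et al.'s printed `γ = (m*k_F/3)(k_B/ħ)²` inverted; SI-2019
  exact `h`, `k_B`, `N_A`, CODATA-2022 `m_e` as a labelled float) and its identity with `(π²/3)k_B²·dos3`; located
  witnesses: SrTi₀.₉₈₄Nb₀.₀₁₆O₃ nominal `n = 2.68–2.69 × 10²⁰ cm⁻³` from `x = 0.016`, `a = 3.9053 Å` (Hall: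
  2.5–2.6 × 10²⁰); Lin et al.'s «m* = 4.2 m_e» certified as `4.20 < m*/m_e < 4.21` from their `γ = 1.55`,
  `n_H = 2.6 × 10²⁰`; Kriener et al.'s SiC:B `x = 0.0395–0.0396` holes per SiC from `n = 1.91 × 10²¹`, `a = 4.3596 Å`;
* LOCATED WITNESSES: `29.608 < 3π² < 29.609` (Kittel prints `k_F = (29.609 N/V)^{1/3}` in cm units);
  Kittel's Cu row `n = 8.45 × 10²² cm⁻³ ⇒ k_F = 1.36 × 10⁸ cm⁻¹` (`13.5 < k_F < 13.6` nm⁻¹ certified);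
  Kriener et al.'s superconducting SiC:B, «`n = 1.91 · 10²¹` cm⁻³ assuming a single spherical Fermi surface
  we obtain … `k_F = (3π²n)^{1/3} = 3.8` nm⁻¹» (`3.8 < k_F < 3.9` certified).

WHAT THIS IS NOT: no statement that any listed material HAS a parabolic band, a single valley or a given
mass; `A`, `g`, `n` are inputs whose provenance is the user's; non-parabolicity, spin–orbit splitting of the
valleys and finite temperature are outside this file. Nothing here is a phase word.

## References
* [Kittel1971] C. Kittel, *Introduction to Solid State Physics*, 4th ed., Wiley (1971), ch. 7 «Free electron
  Fermi gas»: Eq. (18) `ε_F = ħ²k_F²/2m`, Eq. (19) `(V/3π²)k_F³ = N`, Eq. (20) `k_F = (3π²N/V)^{1/3}`,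
  Eq. (21)–(22), Eq. (25) `𝔇(ε_F) = 3N/2ε_F`, Table 1 (note: «`k_F = (3π²N/V)^{1/3} = (29.609 N/V)^{1/3}`»;
  Cu row `8.45 × 10²²` cm⁻³, `1.36 × 10⁸` cm⁻¹), Problem 7.4 («`𝔇(ε) = m/πħ²` per unit area»).
* [KrienerEtAl2008SiCB] M. Kriener, Y. Maeno, T. Oguchi, Z.-A. Ren, J. Kato, T. Muranaka, J. Akimitsu,
  Phys. Rev. B 78 (2008) 024517 = arXiv:0803.1026, §IV.B and Table II («from the charge-carrier concentration
  (`n = 1.91·10²¹` cm⁻³) assuming a single spherical Fermi surface we obtain the Fermi-wave number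
  `k_F = (3π²n)^{1/3} = 3.8` nm⁻¹»); Table I («a_cub = 4.3596 Å», 3C-SiC, `t = 4` formula units per cubic cell).
* [LinEtAl2014SrTiO3Nb] X. Lin, A. Gourgout, G. Bridoux, F. Jomard, A. Pourret, B. Fauqué, D. Aoki, K. Behnia,
  Phys. Rev. B 90 (2014) 140508(R) = arXiv:1409.2423, p. 2 («γ ≃ 1.55 mJ mol⁻¹ K⁻² … n_H = 2.6 × 10²⁰ cm⁻³ … If
  all electrons were in a single spherical Fermi surface, using the expression γ = (m* k_F/3)(k_B/ħ)², one would
  find an effective mass of m* = 4.2 m_e») and Supplement («carrier density of 2.5 × 10²⁰ cm⁻³ corresponding to a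
  Nb content of x = 0.016»; «the carrier concentration … in good agreement with the expected value according to
  the nominal Nb content»).
* [CollignonEtAl2019SrTiO3] C. Collignon, X. Lin, C. W. Rischau, B. Fauqué, K. Behnia, Annu. Rev. Condens. Matter
  Phys. 10 (2019) 25 = arXiv:1804.07067, §2 («SrTiO₃ has a cubic structure … Pm-3m symmetry and a lattice
  parameter of a = 3.9053 Å»).
* [BIPM2019] BIPM, *The International System of Units*, 9th ed. (2019), §2.2 Table 1 (exact `h`, `k`, `N_A`).
* [MohrEtAl2025] P. J. Mohr, D. B. Newell, B. N. Taylor, E. Tiesinga, Rev. Mod. Phys. 97 (2025) 025002 =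
  arXiv:2409.03787 (CODATA 2022), adjusted-constants table («electron mass m_e 9.109 383 7139(28) × 10⁻³¹ kg»).
-/

noncomputable section

open Real

namespace Literature.MathematicalPhysics.QuantumManyBody

namespace CarrierGas

/-! ## §1 Three dimensions: definitions -/

/-- Fermi wavevector of `n` carriers per volume (both spins) distributed over `g` equivalent parabolic valleys:
`k_F = (3π² n/g)^{1/3}` — Kittel's Eq. (20) applied to each valley's `n/g` carriers.
[cite: Kittel1971, ch. 7 Eq. (19)–(20)] -/
def kF3 (n g : ℝ) : ℝ := (3 * π ^ 2 * n / g) ^ ((1 : ℝ) / 3)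

/-- Fermi energy measured from the band edge, `ε_F = A k_F²` with `A = ħ²/(2m*)` the band curvature.
[cite: Kittel1971, ch. 7 Eq. (18), (21)] -/
def eF3 (A n g : ℝ) : ℝ := A * kF3 n g ^ 2

/-- Density of states at the Fermi level per volume, both spins, all `g` valleys: `N(ε_F) = g k_F/(2π² A)`
(one valley, both spins: `m k_F/(π²ħ²) = k_F/(2π²A)`). [cite: Kittel1971, ch. 7 Eq. (25)] -/
def dos3 (A n g : ℝ) : ℝ := g * kF3 n g / (2 * π ^ 2 * A)

/-- The ANTI-ADIABATIC THRESHOLD DENSITY for a boson energy `ω`: `n⋆ = g (ω/A)^{3/2}/(3π²)`, the carrier density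
at which `ε_F = ω` (below it the Fermi energy is smaller than the boson energy). Pure inversion of Kittel (21).
[cite: Kittel1971, ch. 7 Eq. (19), (21)] -/
def nStar (A ω g : ℝ) : ℝ := g * (ω / A) ^ ((3 : ℝ) / 2) / (3 * π ^ 2)

/-- `3π² > 0` (plumbing). [folklore] -/
private lemma three_pi_sq_pos : 0 < 3 * π ^ 2 := by positivity

/-- The radicand `3π²n/g` is nonnegative (plumbing). [folklore] -/
private lemma arg_nonneg {n g : ℝ} (hn : 0 ≤ n) (hg : 0 < g) : 0 ≤ 3 * π ^ 2 * n / g :=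
  div_nonneg (mul_nonneg three_pi_sq_pos.le hn) hg.le

/-- The radicand `3π²n/g` is positive (plumbing). [folklore] -/
private lemma arg_pos {n g : ℝ} (hn : 0 < n) (hg : 0 < g) : 0 < 3 * π ^ 2 * n / g :=
  div_pos (mul_pos three_pi_sq_pos hn) hg

/-- `1/3 = (3 : ℕ)⁻¹` as reals (plumbing for the `rpow` inverse lemmas). [folklore] -/
private lemma one_third_eq : ((1 : ℝ) / 3) = ((3 : ℕ) : ℝ)⁻¹ := by norm_num

/-! ## §2 Three dimensions: count laws and closed forms -/

/-- `k_F ≥ 0`. [cite: Kittel1971, ch. 7 Eq. (20)] -/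
theorem kF3_nonneg {n g : ℝ} (hn : 0 ≤ n) (hg : 0 < g) : 0 ≤ kF3 n g :=
  Real.rpow_nonneg (arg_nonneg hn hg) _

/-- `k_F > 0` for a positive density. [cite: Kittel1971, ch. 7 Eq. (20)] -/
theorem kF3_pos {n g : ℝ} (hn : 0 < n) (hg : 0 < g) : 0 < kF3 n g :=
  Real.rpow_pos_of_pos (arg_pos hn hg) _

/-- `k_F³ = 3π² n/g`. [cite: Kittel1971, ch. 7 Eq. (19)–(20)] -/
theorem kF3_pow_three {n g : ℝ} (hn : 0 ≤ n) (hg : 0 < g) : kF3 n g ^ 3 = 3 * π ^ 2 * n / g := by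
  unfold kF3
  rw [one_third_eq]
  exact Real.rpow_inv_natCast_pow (arg_nonneg hn hg) (by norm_num)

/-- THE COUNT LAW (Kittel (19), one sphere per valley): `g · k_F³/(3π²) = n`.
[cite: Kittel1971, ch. 7 Eq. (19)] -/
theorem count_law3 {n g : ℝ} (hn : 0 ≤ n) (hg : 0 < g) : g * kF3 n g ^ 3 / (3 * π ^ 2) = n := by
  rw [kF3_pow_three hn hg]
  field_simp

/-- `k_F` is the unique nonnegative solution of the count law. [cite: Kittel1971, ch. 7 Eq. (19)–(20)] -/
theorem kF3_eq_of_count {n g k : ℝ} (hg : 0 < g) (hk : 0 ≤ k)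
    (h : g * k ^ 3 / (3 * π ^ 2) = n) : kF3 n g = k := by
  have hn : 3 * π ^ 2 * n / g = k ^ 3 := by
    rw [← h]; field_simp
  unfold kF3
  rw [hn, one_third_eq]
  exact Real.pow_rpow_inv_natCast hk (by norm_num)

/-- `ε_F ≥ 0` for `A ≥ 0`. [cite: Kittel1971, ch. 7 Eq. (21)] -/
theorem eF3_nonneg {A n g : ℝ} (hA : 0 ≤ A) : 0 ≤ eF3 A n g :=
  mul_nonneg hA (sq_nonneg _)

/-- `ε_F > 0` for `A > 0`, `n > 0`. [cite: Kittel1971, ch. 7 Eq. (21)] -/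
theorem eF3_pos {A n g : ℝ} (hA : 0 < A) (hn : 0 < n) (hg : 0 < g) : 0 < eF3 A n g :=
  mul_pos hA (pow_pos (kF3_pos hn hg) 2)

/-- `N(ε_F) ≥ 0`. [cite: Kittel1971, ch. 7 Eq. (25)] -/
theorem dos3_nonneg {A n g : ℝ} (hA : 0 ≤ A) (hn : 0 ≤ n) (hg : 0 < g) : 0 ≤ dos3 A n g :=
  div_nonneg (mul_nonneg hg.le (kF3_nonneg hn hg)) (by positivity)

/-- `N(ε_F) > 0`. [cite: Kittel1971, ch. 7 Eq. (25)] -/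
theorem dos3_pos {A n g : ℝ} (hA : 0 < A) (hn : 0 < n) (hg : 0 < g) : 0 < dos3 A n g :=
  div_pos (mul_pos hg (kF3_pos hn hg)) (by positivity)

/-- KITTEL (25): `N(ε_F) · ε_F = (3/2) n` — density of states times Fermi energy is three halves of the
carrier density, for every mass, valley number and density. [cite: Kittel1971, ch. 7 Eq. (25)] -/
theorem dos3_mul_eF3 {A n g : ℝ} (hA : A ≠ 0) (hn : 0 ≤ n) (hg : 0 < g) :
    dos3 A n g * eF3 A n g = 3 / 2 * n := by
  unfold dos3 eF3
  have h3 := kF3_pow_three hn hg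
  have hπ : (π : ℝ) ^ 2 ≠ 0 := by positivity
  have : g * kF3 n g / (2 * π ^ 2 * A) * (A * kF3 n g ^ 2) = g * kF3 n g ^ 3 / (2 * π ^ 2) := by
    field_simp
  rw [this, h3]
  field_simp

/-- KITTEL (25) solved for the density of states: `N(ε_F) = 3n/(2ε_F)`. [cite: Kittel1971, ch. 7 Eq. (25)] -/
theorem dos3_eq_three_halves_div {A n g : ℝ} (hA : 0 < A) (hn : 0 < n) (hg : 0 < g) :
    dos3 A n g = 3 / 2 * n / eF3 A n g := by
  have h := dos3_mul_eF3 hA.ne' hn.le hg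
  have hε := (eF3_pos hA hn hg).ne'
  field_simp
  linarith [h]

/-! ## §3 Three dimensions: monotonicity, scaling, box rules -/

/-- `k_F` is strictly increasing in the density. [cite: Kittel1971, ch. 7 Eq. (20)] -/
theorem kF3_lt_kF3_of_lt {n₁ n₂ g : ℝ} (hn₁ : 0 ≤ n₁) (h : n₁ < n₂) (hg : 0 < g) :
    kF3 n₁ g < kF3 n₂ g := by
  unfold kF3
  apply Real.rpow_lt_rpow (arg_nonneg hn₁ hg) _ (by norm_num)
  exact div_lt_div_of_pos_right (mul_lt_mul_of_pos_left h three_pi_sq_pos) hg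

/-- `k_F` is monotone in the density. [cite: Kittel1971, ch. 7 Eq. (20)] -/
theorem kF3_le_kF3_of_le {n₁ n₂ g : ℝ} (hn₁ : 0 ≤ n₁) (h : n₁ ≤ n₂) (hg : 0 < g) :
    kF3 n₁ g ≤ kF3 n₂ g := by
  unfold kF3
  apply Real.rpow_le_rpow (arg_nonneg hn₁ hg) _ (by norm_num)
  exact div_le_div_of_nonneg_right (mul_le_mul_of_nonneg_left h three_pi_sq_pos.le) hg.le

/-- More valleys at fixed total density ⇒ smaller `k_F`. [cite: Kittel1971, ch. 7 Eq. (19)–(20)] -/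
theorem kF3_lt_kF3_of_valley_lt {n g₁ g₂ : ℝ} (hn : 0 < n) (hg₁ : 0 < g₁) (h : g₁ < g₂) :
    kF3 n g₂ < kF3 n g₁ := by
  unfold kF3
  apply Real.rpow_lt_rpow (arg_nonneg hn.le (hg₁.trans h)) _ (by norm_num)
  exact div_lt_div_of_pos_left (mul_pos three_pi_sq_pos hn) hg₁ h

/-- `ε_F` is strictly increasing in the density (`A > 0`). [cite: Kittel1971, ch. 7 Eq. (21)] -/
theorem eF3_lt_eF3_of_lt {A n₁ n₂ g : ℝ} (hA : 0 < A) (hn₁ : 0 ≤ n₁) (h : n₁ < n₂) (hg : 0 < g) :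
    eF3 A n₁ g < eF3 A n₂ g := by
  unfold eF3
  have h1 := kF3_lt_kF3_of_lt hn₁ h hg
  have h0 := kF3_nonneg hn₁ hg
  exact mul_lt_mul_of_pos_left (by nlinarith) hA

/-- `ε_F` is monotone in the density (`A ≥ 0`). [cite: Kittel1971, ch. 7 Eq. (21)] -/
theorem eF3_le_eF3_of_le {A n₁ n₂ g : ℝ} (hA : 0 ≤ A) (hn₁ : 0 ≤ n₁) (h : n₁ ≤ n₂) (hg : 0 < g) :
    eF3 A n₁ g ≤ eF3 A n₂ g := by
  unfold eF3
  have h1 := kF3_le_kF3_of_le hn₁ h hg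
  have h0 := kF3_nonneg hn₁ hg
  exact mul_le_mul_of_nonneg_left (by nlinarith) hA

/-- More valleys ⇒ lower `ε_F` at fixed `n`. [cite: Kittel1971, ch. 7 Eq. (21)] -/
theorem eF3_lt_eF3_of_valley_lt {A n g₁ g₂ : ℝ} (hA : 0 < A) (hn : 0 < n) (hg₁ : 0 < g₁) (h : g₁ < g₂) :
    eF3 A n g₂ < eF3 A n g₁ := by
  unfold eF3
  have h1 := kF3_lt_kF3_of_valley_lt hn hg₁ h
  have h0 := (kF3_pos hn (hg₁.trans h)).le
  exact mul_lt_mul_of_pos_left (by nlinarith) hA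

/-- A larger band curvature `A` (lighter mass) raises `ε_F` at fixed `n`. [cite: Kittel1971, ch. 7 Eq. (21)] -/
theorem eF3_le_eF3_of_curv_le {A₁ A₂ n g : ℝ} (h : A₁ ≤ A₂) : eF3 A₁ n g ≤ eF3 A₂ n g :=
  mul_le_mul_of_nonneg_right h (sq_nonneg _)

/-- `N(ε_F)` is strictly increasing in the density (`∝ n^{1/3}`). [cite: Kittel1971, ch. 7 Eq. (25)] -/
theorem dos3_lt_dos3_of_lt {A n₁ n₂ g : ℝ} (hA : 0 < A) (hn₁ : 0 ≤ n₁) (h : n₁ < n₂) (hg : 0 < g) :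
    dos3 A n₁ g < dos3 A n₂ g := by
  unfold dos3
  apply div_lt_div_of_pos_right _ (by positivity)
  exact mul_lt_mul_of_pos_left (kF3_lt_kF3_of_lt hn₁ h hg) hg

/-- `N(ε_F)` is monotone in the density. [cite: Kittel1971, ch. 7 Eq. (25)] -/
theorem dos3_le_dos3_of_le {A n₁ n₂ g : ℝ} (hA : 0 < A) (hn₁ : 0 ≤ n₁) (h : n₁ ≤ n₂) (hg : 0 < g) :
    dos3 A n₁ g ≤ dos3 A n₂ g := by
  unfold dos3
  apply div_le_div_of_nonneg_right _ (by positivity)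
  exact mul_le_mul_of_nonneg_left (kF3_le_kF3_of_le hn₁ h hg) hg.le

/-- A heavier band mass (smaller `A`) raises `N(ε_F)` at fixed `n`, `g`. [cite: Kittel1971, ch. 7 Eq. (25)] -/
theorem dos3_lt_dos3_of_curv_lt {A₁ A₂ n g : ℝ} (hA₁ : 0 < A₁) (h : A₁ < A₂) (hn : 0 < n) (hg : 0 < g) :
    dos3 A₂ n g < dos3 A₁ n g := by
  unfold dos3
  apply div_lt_div_of_pos_left (mul_pos hg (kF3_pos hn hg)) (by positivity)
  have hπ2 : (0 : ℝ) < π ^ 2 := by positivity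
  nlinarith [hπ2]

/-- SCALING: multiplying the density by `c³` multiplies `k_F` by `c`. [cite: Kittel1971, ch. 7 Eq. (20)] -/
theorem kF3_cube_mul {n g c : ℝ} (hn : 0 ≤ n) (hg : 0 < g) (hc : 0 ≤ c) :
    kF3 (c ^ 3 * n) g = c * kF3 n g := by
  apply kF3_eq_of_count hg (mul_nonneg hc (kF3_nonneg hn hg))
  rw [mul_pow, kF3_pow_three hn hg]
  field_simp

/-- … hence `×8` in density is `×2` in `k_F`. [cite: Kittel1971, ch. 7 Eq. (20)] -/
theorem kF3_eight_mul {n g : ℝ} (hn : 0 ≤ n) (hg : 0 < g) : kF3 (8 * n) g = 2 * kF3 n g := by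
  have := kF3_cube_mul hn hg (show (0 : ℝ) ≤ 2 by norm_num)
  norm_num at this
  exact this

/-- … and `×4` in `ε_F`. [cite: Kittel1971, ch. 7 Eq. (21)] -/
theorem eF3_eight_mul {A n g : ℝ} (hn : 0 ≤ n) (hg : 0 < g) : eF3 A (8 * n) g = 4 * eF3 A n g := by
  unfold eF3
  rw [kF3_eight_mul hn hg]
  ring

/-- BOX → BAND for `ε_F`: a density box `[n₋, n₊]` maps onto `[ε_F(n₋), ε_F(n₊)]` at fixed `A ≥ 0`, `g`.
[cite: Kittel1971, ch. 7 Eq. (21)] -/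
theorem eF3_mem_Icc_of_mem_Icc {A nlo nhi n g : ℝ} (hA : 0 ≤ A) (hlo : 0 ≤ nlo) (hg : 0 < g)
    (hn : n ∈ Set.Icc nlo nhi) : eF3 A n g ∈ Set.Icc (eF3 A nlo g) (eF3 A nhi g) :=
  ⟨eF3_le_eF3_of_le hA hlo hn.1 hg, eF3_le_eF3_of_le hA (hlo.trans hn.1) hn.2 hg⟩

/-- BOX → BAND for `N(ε_F)`. [cite: Kittel1971, ch. 7 Eq. (25)] -/
theorem dos3_mem_Icc_of_mem_Icc {A nlo nhi n g : ℝ} (hA : 0 < A) (hlo : 0 ≤ nlo) (hg : 0 < g)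
    (hn : n ∈ Set.Icc nlo nhi) : dos3 A n g ∈ Set.Icc (dos3 A nlo g) (dos3 A nhi g) :=
  ⟨dos3_le_dos3_of_le hA hlo hn.1 hg, dos3_le_dos3_of_le hA (hlo.trans hn.1) hn.2 hg⟩

/-! ## §4 The anti-adiabatic threshold density -/

/-- `n⋆ > 0`. [cite: Kittel1971, ch. 7 Eq. (21)] -/
theorem nStar_pos {A ω g : ℝ} (hA : 0 < A) (hω : 0 < ω) (hg : 0 < g) : 0 < nStar A ω g := by
  unfold nStar
  exact div_pos (mul_pos hg (Real.rpow_pos_of_pos (div_pos hω hA) _)) three_pi_sq_pos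

/-- At the threshold density the Fermi wavevector is `(ω/A)^{1/2}`. [cite: Kittel1971, ch. 7 Eq. (19)–(21)] -/
theorem kF3_nStar {A ω g : ℝ} (hA : 0 < A) (hω : 0 ≤ ω) (hg : 0 < g) :
    kF3 (nStar A ω g) g = (ω / A) ^ ((1 : ℝ) / 2) := by
  have hωA : 0 ≤ ω / A := div_nonneg hω hA.le
  apply kF3_eq_of_count hg (Real.rpow_nonneg hωA _)
  unfold nStar
  have h3 : ((ω / A) ^ ((1 : ℝ) / 2)) ^ 3 = (ω / A) ^ ((3 : ℝ) / 2) := by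
    rw [← Real.rpow_natCast, ← Real.rpow_mul hωA]
    norm_num
  rw [h3]

/-- AT the threshold density, `ε_F = ω` exactly. [cite: Kittel1971, ch. 7 Eq. (21)] -/
theorem eF3_nStar {A ω g : ℝ} (hA : 0 < A) (hω : 0 ≤ ω) (hg : 0 < g) : eF3 A (nStar A ω g) g = ω := by
  unfold eF3
  rw [kF3_nStar hA hω hg]
  have hωA : 0 ≤ ω / A := div_nonneg hω hA.le
  have h2 : ((ω / A) ^ ((1 : ℝ) / 2)) ^ 2 = ω / A := by
    rw [← Real.rpow_natCast, ← Real.rpow_mul hωA]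
    norm_num
  rw [h2]
  field_simp

/-- **THE ANTI-ADIABATIC CRITERION AS A DENSITY THRESHOLD**: `ε_F < ω ↔ n < n⋆(A, ω, g)` — below the threshold
density the Fermi energy is smaller than the boson energy `ω` (Migdal's parameter `ω/ε_F` exceeds one), above
it larger; exact for every `A > 0`, `g > 0`. [cite: Kittel1971, ch. 7 Eq. (19), (21)] -/
theorem eF3_lt_iff_lt_nStar {A ω n g : ℝ} (hA : 0 < A) (hω : 0 ≤ ω) (hn : 0 ≤ n) (hg : 0 < g) :
    eF3 A n g < ω ↔ n < nStar A ω g := by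
  have hstar : 0 ≤ nStar A ω g := by
    unfold nStar
    exact div_nonneg (mul_nonneg hg.le (Real.rpow_nonneg (div_nonneg hω hA.le) _)) three_pi_sq_pos.le
  constructor
  · intro h
    by_contra hle
    push Not at hle
    have := eF3_le_eF3_of_le hA.le hstar hle hg
    rw [eF3_nStar hA hω hg] at this
    linarith
  · intro h
    have := eF3_lt_eF3_of_lt hA hn h hg
    rwa [eF3_nStar hA hω hg] at this

/-- … and `ω ≤ ε_F ↔ n⋆ ≤ n`. [cite: Kittel1971, ch. 7 Eq. (19), (21)] -/
theorem le_eF3_iff_nStar_le {A ω n g : ℝ} (hA : 0 < A) (hω : 0 ≤ ω) (hn : 0 ≤ n) (hg : 0 < g) :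
    ω ≤ eF3 A n g ↔ nStar A ω g ≤ n := by
  rw [← not_lt, eF3_lt_iff_lt_nStar hA hω hn hg, not_lt]

/-! ## §5 Two dimensions -/

/-- 2D Fermi wavevector of `n₂` carriers per area (both spins) in `g` equivalent valleys: `k_F = (2π n₂/g)^{1/2}`
(two spins × disc area `πk_F²` / `(2π)²` per valley `= n₂/g`). [cite: Kittel1971, ch. 7 Problem 4] -/
def kF2 (n₂ g : ℝ) : ℝ := (2 * π * n₂ / g) ^ ((1 : ℝ) / 2)

/-- 2D Fermi energy from the band edge: `ε_F = 2πA n₂/g` — LINEAR in the areal density.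
[cite: Kittel1971, ch. 7 Problem 4] -/
def eF2 (A n₂ g : ℝ) : ℝ := 2 * π * A * n₂ / g

/-- 2D density of states per area, both spins, `g` valleys: `g/(2πA) = g·m*/(πħ²)` — it has NO density argument:
«the density of orbitals of a free electron gas in two dimensions is independent of energy».
[cite: Kittel1971, ch. 7 Problem 4] -/
def dos2 (A g : ℝ) : ℝ := g / (2 * π * A)

/-- The 2D radicand `2πn/g` is nonnegative (plumbing). [folklore] -/
private lemma arg2_nonneg {n g : ℝ} (hn : 0 ≤ n) (hg : 0 < g) : 0 ≤ 2 * π * n / g :=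
  div_nonneg (mul_nonneg (by positivity) hn) hg.le

/-- `1/2 = (2 : ℕ)⁻¹` as reals (plumbing). [folklore] -/
private lemma one_half_eq : ((1 : ℝ) / 2) = ((2 : ℕ) : ℝ)⁻¹ := by norm_num

/-- `k_F² = 2π n₂/g` (the 2D count law). [cite: Kittel1971, ch. 7 Problem 4] -/
theorem kF2_sq {n g : ℝ} (hn : 0 ≤ n) (hg : 0 < g) : kF2 n g ^ 2 = 2 * π * n / g := by
  unfold kF2
  rw [one_half_eq]
  exact Real.rpow_inv_natCast_pow (arg2_nonneg hn hg) (by norm_num)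

/-- The 2D count law `g k_F²/(2π) = n₂`. [cite: Kittel1971, ch. 7 Problem 4] -/
theorem count_law2 {n g : ℝ} (hn : 0 ≤ n) (hg : 0 < g) : g * kF2 n g ^ 2 / (2 * π) = n := by
  rw [kF2_sq hn hg]
  have hπ : (π : ℝ) ≠ 0 := Real.pi_ne_zero
  field_simp

/-- `ε_F = A k_F²` in 2D as well (consistency of the closed form). [cite: Kittel1971, ch. 7 Eq. (18), Problem 4] -/
theorem eF2_eq_curv_mul_kF2_sq {A n g : ℝ} (hn : 0 ≤ n) (hg : 0 < g) : eF2 A n g = A * kF2 n g ^ 2 := by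
  rw [kF2_sq hn hg]
  unfold eF2
  ring

/-- THE 2D COUNT LAW IN DOS FORM: `N(ε_F) · ε_F = n₂` — a constant density of states filled up to `ε_F`.
[cite: Kittel1971, ch. 7 Problem 4] -/
theorem dos2_mul_eF2 {A n g : ℝ} (hA : A ≠ 0) (hg : g ≠ 0) : dos2 A g * eF2 A n g = n := by
  unfold dos2 eF2
  have hπ : (π : ℝ) ≠ 0 := Real.pi_ne_zero
  field_simp

/-- `ε_F` is linear in the areal density: slope `2πA/g = 1/N(ε_F)`. [cite: Kittel1971, ch. 7 Problem 4] -/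
theorem eF2_eq_div_dos2 {A n g : ℝ} (hA : A ≠ 0) (hg : g ≠ 0) : eF2 A n g = n / dos2 A g := by
  have h := dos2_mul_eF2 (n := n) hA hg
  have hd : dos2 A g ≠ 0 := by
    unfold dos2
    have hπ : (π : ℝ) ≠ 0 := Real.pi_ne_zero
    positivity
  field_simp
  linarith [h]

/-- Additivity (linearity) of the 2D Fermi energy in the density. [cite: Kittel1971, ch. 7 Problem 4] -/
theorem eF2_add {A n m g : ℝ} : eF2 A (n + m) g = eF2 A n g + eF2 A m g := by
  unfold eF2
  ring

/-- `dε_F/dn₂ = 1/N(ε_F)` (2D, exact). [cite: Kittel1971, ch. 7 Problem 4] -/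
theorem hasDerivAt_eF2 {A g : ℝ} (hA : A ≠ 0) (hg : g ≠ 0) (n : ℝ) :
    HasDerivAt (fun x => eF2 A x g) (1 / dos2 A g) n := by
  have hd : (fun x => eF2 A x g) = fun x => x * (2 * π * A / g) := by
    funext x; unfold eF2; ring
  have hc : 1 / dos2 A g = 2 * π * A / g := by
    unfold dos2
    have hπ : (π : ℝ) ≠ 0 := Real.pi_ne_zero
    field_simp
  rw [hd, hc]
  simpa using (hasDerivAt_id n).mul_const (2 * π * A / g)

/-- `N(ε_F) > 0` in 2D. [cite: Kittel1971, ch. 7 Problem 4] -/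
theorem dos2_pos {A g : ℝ} (hA : 0 < A) (hg : 0 < g) : 0 < dos2 A g := by
  unfold dos2; positivity

/-- A heavier 2D band mass (smaller `A`) gives a larger, still density-independent, `N(ε_F)`.
[cite: Kittel1971, ch. 7 Problem 4] -/
theorem dos2_lt_dos2_of_curv_lt {A₁ A₂ g : ℝ} (hA₁ : 0 < A₁) (h : A₁ < A₂) (hg : 0 < g) :
    dos2 A₂ g < dos2 A₁ g := by
  unfold dos2
  apply div_lt_div_of_pos_left hg (by positivity)
  nlinarith [Real.pi_pos]

/-! ## §6 Located numerical witnesses -/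

/-- KITTEL'S PRINTED CONSTANT: «`k_F = (3π² N/V)^{1/3} = (29.609 N/V)^{1/3}`» — `29.608 < 3π² < 29.609`
(the printed value is the rounding of `29.6088…`). [cite: Kittel1971, ch. 7 Table 1 (note)] -/
theorem three_pi_sq_bounds : 29.608 < 3 * π ^ 2 ∧ 3 * π ^ 2 < 29.609 := by
  have h1 : (3.141592 : ℝ) < π := Real.pi_gt_d6
  have h2 : π < 3.141593 := Real.pi_lt_d6
  constructor <;> nlinarith [h1, h2, Real.pi_pos]

/-- Helper: a cube sandwich `a³ < 3π²n/g < b³` gives the `k_F` sandwich `a < k_F < b` (plumbing for the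
numerical witnesses). [folklore] -/
private lemma kF3_bounds_of_cube {n g a b : ℝ} (hn : 0 ≤ n) (hg : 0 < g) (hb : 0 ≤ b)
    (hlo : a ^ 3 < 3 * π ^ 2 * n / g) (hhi : 3 * π ^ 2 * n / g < b ^ 3) :
    a < kF3 n g ∧ kF3 n g < b := by
  have h3 := kF3_pow_three hn hg
  have hk := kF3_nonneg hn hg
  constructor
  · by_contra hle
    push Not at hle
    have := pow_le_pow_left₀ hk hle 3
    linarith
  · by_contra hle
    push Not at hle
    have := pow_le_pow_left₀ hb hle 3
    linarith

/-- KITTEL'S Cu ROW: `n = 8.45 × 10²² cm⁻³ = 84.5 nm⁻³`, one valley ⇒ `13.5 < k_F < 13.6` nm⁻¹, the printed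
`1.36 × 10⁸ cm⁻¹`. [cite: Kittel1971, ch. 7 Table 1 (Cu)] -/
theorem kittel_copper_kF : 13.5 < kF3 84.5 1 ∧ kF3 84.5 1 < 13.6 := by
  have hπ := three_pi_sq_bounds
  apply kF3_bounds_of_cube (by norm_num) (by norm_num) (by norm_num)
  · have : (13.5 : ℝ) ^ 3 < 29.608 * 84.5 / 1 := by norm_num
    calc (13.5 : ℝ) ^ 3 < 29.608 * 84.5 / 1 := this
      _ < 3 * π ^ 2 * 84.5 / 1 := by nlinarith [hπ.1]
  · have : (29.609 : ℝ) * 84.5 / 1 < 13.6 ^ 3 := by norm_num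
    calc 3 * π ^ 2 * 84.5 / 1 < 29.609 * 84.5 / 1 := by nlinarith [hπ.2]
      _ < (13.6 : ℝ) ^ 3 := this

/-- KRIENER ET AL.'S SUPERCONDUCTING SiC:B (`T_c = 1.45` K): «`n = 1.91·10²¹` cm⁻³ [= 1.91 nm⁻³] assuming a single
spherical Fermi surface … `k_F = (3π²n)^{1/3} = 3.8` nm⁻¹» — certified `3.8 < k_F < 3.9` nm⁻¹.
[cite: KrienerEtAl2008SiCB, §IV.B and Table II] -/
theorem kriener_SiCB_kF : 3.8 < kF3 1.91 1 ∧ kF3 1.91 1 < 3.9 := by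
  have hπ := three_pi_sq_bounds
  apply kF3_bounds_of_cube (by norm_num) (by norm_num) (by norm_num)
  · have : (3.8 : ℝ) ^ 3 < 29.608 * 1.91 / 1 := by norm_num
    calc (3.8 : ℝ) ^ 3 < 29.608 * 1.91 / 1 := this
      _ < 3 * π ^ 2 * 1.91 / 1 := by nlinarith [hπ.1]
  · have : (29.609 : ℝ) * 1.91 / 1 < 3.9 ^ 3 := by norm_num
    calc 3 * π ^ 2 * 1.91 / 1 < 29.609 * 1.91 / 1 := by nlinarith [hπ.2]
      _ < (3.9 : ℝ) ^ 3 := this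

/-- The same carriers spread over `g = 3` equivalent pockets (e.g. three degenerate valence-band or t₂g-derived
sheets counted as equal spheres) have a smaller `k_F`: `2.6 < k_F < 2.8` nm⁻¹ at `n = 1.91` nm⁻³ — the valley
lever of the count law on the same printed density. [cite: Kittel1971, ch. 7 Eq. (19)–(20)]
[cite: KrienerEtAl2008SiCB, Table II] -/
theorem kriener_SiCB_kF_threeValley : 2.6 < kF3 1.91 3 ∧ kF3 1.91 3 < 2.8 := by
  have hπ := three_pi_sq_bounds
  apply kF3_bounds_of_cube (by norm_num) (by norm_num) (by norm_num)
  · have : (2.6 : ℝ) ^ 3 < 29.608 * 1.91 / 3 := by norm_num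
    calc (2.6 : ℝ) ^ 3 < 29.608 * 1.91 / 3 := this
      _ < 3 * π ^ 2 * 1.91 / 3 := by nlinarith [hπ.1]
  · have : (29.609 : ℝ) * 1.91 / 3 < 2.8 ^ 3 := by norm_num
    calc 3 * π ^ 2 * 1.91 / 3 < 29.609 * 1.91 / 3 := by nlinarith [hπ.2]
      _ < (2.8 : ℝ) ^ 3 := this

/-! ## §7 Dopant count ↔ carrier density, and the single-sphere Sommerfeld mass -/

/-- Carrier density from a dopant (or carrier) count `x` per formula unit, `Z` formula units per cell of volume `V`:
`n = xZ/V` (the rigid-band / virtual-crystal electron count every jellium leg uses).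
[cite: LinEtAl2014SrTiO3Nb, Supplement («2.5 × 10²⁰ cm⁻³ corresponding to … x = 0.016»)] -/
def carrierDensity3 (x Z V : ℝ) : ℝ := x * Z / V

/-- The inverse bookkeeping: carriers per formula unit from a measured density, `x = nV/Z`.
[cite: KrienerEtAl2008SiCB, Table I–II] -/
def dopantPerFU (n Z V : ℝ) : ℝ := n * V / Z

/-- Areal carrier density from `x` carriers per formula unit, `Z_ℓ` formula units per LAYER per 2D cell of area `S`:
`n₂ = xZ_ℓ/S`. [cite: Kittel1971, ch. 7 Problem 4] -/
def carrierDensity2 (x Zl S : ℝ) : ℝ := x * Zl / S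

/-- Round trip `x ↦ n ↦ x`. [cite: KrienerEtAl2008SiCB, Table II] -/
theorem dopantPerFU_carrierDensity3 {x Z V : ℝ} (hZ : Z ≠ 0) (hV : V ≠ 0) :
    dopantPerFU (carrierDensity3 x Z V) Z V = x := by
  unfold dopantPerFU carrierDensity3
  field_simp

/-- Round trip `n ↦ x ↦ n`. [cite: KrienerEtAl2008SiCB, Table II] -/
theorem carrierDensity3_dopantPerFU {n Z V : ℝ} (hZ : Z ≠ 0) (hV : V ≠ 0) :
    carrierDensity3 (dopantPerFU n Z V) Z V = n := by
  unfold dopantPerFU carrierDensity3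
  field_simp

/-- `n` is strictly increasing in `x` (`Z, V > 0`). [cite: LinEtAl2014SrTiO3Nb, Supplement] -/
theorem carrierDensity3_lt_of_lt {x₁ x₂ Z V : ℝ} (hZ : 0 < Z) (hV : 0 < V) (h : x₁ < x₂) :
    carrierDensity3 x₁ Z V < carrierDensity3 x₂ Z V := by
  unfold carrierDensity3
  exact div_lt_div_of_pos_right (mul_lt_mul_of_pos_right h hZ) hV

/-- `n ≥ 0` for `x, Z, V ≥ 0`. [cite: LinEtAl2014SrTiO3Nb, Supplement] -/
theorem carrierDensity3_nonneg {x Z V : ℝ} (hx : 0 ≤ x) (hZ : 0 ≤ Z) (hV : 0 ≤ V) :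
    0 ≤ carrierDensity3 x Z V :=
  div_nonneg (mul_nonneg hx hZ) hV

/-- In a 2D parabolic band the Fermi energy is LINEAR in the dopant count `x` at fixed cell and mass:
`ε_F = x · (2πA Z_ℓ/(g S))` — while `N(ε_F) = g/(2πA)` does not see `x` at all.
[cite: Kittel1971, ch. 7 Problem 4] -/
theorem eF2_carrierDensity2 {A x Zl S g : ℝ} :
    eF2 A (carrierDensity2 x Zl S) g = x * (2 * π * A * Zl / (g * S)) := by
  unfold eF2 carrierDensity2
  ring

/-- The Planck constant `h = 6.62607015 × 10⁻³⁴ J s`, exact since the 2019 SI redefinition.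
[cite: BIPM2019, §2.2 Table 1] -/
def planckH : ℝ := 6.62607015e-34

/-- `ħ = h/(2π)`. [cite: BIPM2019, §2.2 Table 1] -/
def hbar : ℝ := planckH / (2 * π)

/-- The electron mass, CODATA 2022 recommended value `9.109 383 7139(28) × 10⁻³¹ kg` — a MEASURED constant (relative
uncertainty `3.1 × 10⁻¹⁰`), carried here as a labelled float used only to express band masses in units of `m_e`.
[cite: MohrEtAl2025, adjusted-constants table (electron mass)] -/
def electronMassKg : ℝ := 9.1093837139e-31

/-- `ħ > 0`. [cite: BIPM2019, §2.2 Table 1] -/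
theorem hbar_pos : 0 < hbar := by
  unfold hbar planckH
  positivity

/-- THE SINGLE-SPHERE SOMMERFELD COEFFICIENT PER VOLUME, as printed by Lin et al.: `γ_vol = (m* k_F/3)(k_B/ħ)²`
(all carriers in one spherical Fermi surface). [cite: LinEtAl2014SrTiO3Nb, p. 2] -/
def singleSphereGammaVol (m kF : ℝ) : ℝ := m * kF / 3 * (Sommerfeld.kB / hbar) ^ 2

/-- … inverted for the mass: `m* = 3ħ²γ_vol/(k_B² k_F)`. [cite: LinEtAl2014SrTiO3Nb, p. 2] -/
def singleSphereMass (γvol kF : ℝ) : ℝ := 3 * hbar ^ 2 * γvol / (Sommerfeld.kB ^ 2 * kF)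

/-- Lin et al.'s expression IS the Sommerfeld formula `γ = (π²/3)k_B² N(ε_F)` [Kittel] evaluated on the one-valley
parabolic density of states `N(ε_F) = m k_F/(π²ħ²) = dos3 (ħ²/2m) n 1` at `k_F = kF3 n 1`.
[cite: LinEtAl2014SrTiO3Nb, p. 2] [cite: Kittel1971, ch. 7 Eq. (25)] -/
theorem singleSphereGammaVol_eq_sommerfeld {m n : ℝ} (hm : 0 < m) :
    singleSphereGammaVol m (kF3 n 1) = π ^ 2 / 3 * Sommerfeld.kB ^ 2 * dos3 (hbar ^ 2 / (2 * m)) n 1 := by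
  unfold singleSphereGammaVol dos3
  have hħ : hbar ≠ 0 := hbar_pos.ne'
  have hπ : (π : ℝ) ≠ 0 := Real.pi_ne_zero
  have hm' : m ≠ 0 := hm.ne'
  field_simp

/-- Round trip: the mass read off the single-sphere `γ_vol` is the mass put in (`k_F ≠ 0`).
[cite: LinEtAl2014SrTiO3Nb, p. 2] -/
theorem singleSphereMass_gammaVol {m kF : ℝ} (hkF : kF ≠ 0) :
    singleSphereMass (singleSphereGammaVol m kF) kF = m := by
  unfold singleSphereMass singleSphereGammaVol
  have hħ : hbar ≠ 0 := hbar_pos.ne'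
  have hk : Sommerfeld.kB ≠ 0 := by unfold Sommerfeld.kB; norm_num
  field_simp

/-- At fixed `γ_vol`, a LARGER `k_F` (more carriers in the sphere) means a SMALLER inferred mass — the direction of the
single-sphere estimate's bias when several pockets share the carriers. [cite: LinEtAl2014SrTiO3Nb, p. 2] -/
theorem singleSphereMass_lt_of_kF_lt {γvol k₁ k₂ : ℝ} (hγ : 0 < γvol) (hk₁ : 0 < k₁) (h : k₁ < k₂) :
    singleSphereMass γvol k₂ < singleSphereMass γvol k₁ := by
  unfold singleSphereMass
  have hħ := hbar_pos
  have hk : 0 < Sommerfeld.kB := by unfold Sommerfeld.kB; norm_num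
  apply div_lt_div_of_pos_left (by positivity) (by positivity)
  exact mul_lt_mul_of_pos_left h (by positivity)

/-- The cubic-perovskite molar volume of SrTiO₃ used to convert a molar `γ` into `γ_vol`: `N_A · a³` with the located
room-temperature `a = 3.9053 Å`. [cite: CollignonEtAl2019SrTiO3, §2] [cite: BIPM2019, §2.2 Table 1] -/
def srTiO3MolarVolume : ℝ := Sommerfeld.NA * (3.9053e-10) ^ 3

/-- Lin et al.'s normal-state `γ ≃ 1.55 mJ mol⁻¹ K⁻²` of SrTi₀.₉₈₄Nb₀.₀₁₆O₃ per unit volume (J K⁻² m⁻³).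
[cite: LinEtAl2014SrTiO3Nb, p. 2] -/
def lin2014GammaVol : ℝ := 1.55e-3 / srTiO3MolarVolume

/-- NOMINAL CARRIER DENSITY OF SrTi₁₋ₓNbₓO₃ AT `x = 0.016` (one electron per Nb, `Z = 1`, `a = 3.9053 Å`):
`2.68 × 10²⁶ < n < 2.69 × 10²⁶` m⁻³, i.e. `2.68–2.69 × 10²⁰ cm⁻³` — beside the printed Hall values
`2.5–2.6 × 10²⁰ cm⁻³` («in good agreement with the expected value according to the nominal Nb content»).
[cite: LinEtAl2014SrTiO3Nb, Supplement] [cite: CollignonEtAl2019SrTiO3, §2] -/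
theorem srTiO3Nb_nominal_density :
    2.68e26 < carrierDensity3 0.016 1 ((3.9053e-10 : ℝ) ^ 3) ∧
      carrierDensity3 0.016 1 ((3.9053e-10 : ℝ) ^ 3) < 2.69e26 := by
  unfold carrierDensity3
  constructor <;> norm_num

/-- KRIENER ET AL.'S SiC:B HOLE COUNT PER FORMULA UNIT from their Hall density `n = 1.91 × 10²¹ cm⁻³` and the 3C cell
(`a = 4.3596 Å`, four SiC per cubic cell): `0.0395 < x < 0.0396` — the «x = 0.04» of the validation row is this
derived number. [cite: KrienerEtAl2008SiCB, Table I–II] -/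
theorem kriener_SiCB_holes_per_fu :
    0.0395 < dopantPerFU 1.91e27 4 ((4.3596e-10 : ℝ) ^ 3) ∧
      dopantPerFU 1.91e27 4 ((4.3596e-10 : ℝ) ^ 3) < 0.0396 := by
  unfold dopantPerFU
  constructor <;> norm_num

/-- `k_F` of `n_H = 2.6 × 10²⁰ cm⁻³` in ONE sphere: `1.9745 × 10⁹ < k_F < 1.9746 × 10⁹` m⁻¹.
[cite: LinEtAl2014SrTiO3Nb, p. 2] [cite: Kittel1971, ch. 7 Eq. (20)] -/
theorem lin2014_kF_bounds : 1.9745e9 < kF3 2.6e26 1 ∧ kF3 2.6e26 1 < 1.9746e9 := by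
  have hπ := three_pi_sq_bounds
  apply kF3_bounds_of_cube (by norm_num) (by norm_num) (by norm_num)
  · have : (1.9745e9 : ℝ) ^ 3 < 29.608 * 2.6e26 / 1 := by norm_num
    calc (1.9745e9 : ℝ) ^ 3 < 29.608 * 2.6e26 / 1 := this
      _ < 3 * π ^ 2 * 2.6e26 / 1 := by nlinarith [hπ.1]
  · have : (29.609 : ℝ) * 2.6e26 / 1 < 1.9746e9 ^ 3 := by norm_num
    calc 3 * π ^ 2 * 2.6e26 / 1 < 29.609 * 2.6e26 / 1 := by nlinarith [hπ.2]
      _ < (1.9746e9 : ℝ) ^ 3 := this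

/-- **LIN ET AL.'S «m* = 4.2 m_e» CERTIFIED**: from their printed `γ ≃ 1.55 mJ mol⁻¹ K⁻²` and `n_H = 2.6 × 10²⁰ cm⁻³`,
one sphere, the SI-2019 exact `h`, `k_B`, `N_A`, the located `a = 3.9053 Å` and the CODATA-2022 electron mass:
`4.20 < m*/m_e < 4.21`. (Their quantum-oscillation reading puts the carriers in three bands with the heaviest
`≈ 4 m_e` — the single-sphere number is the located upper-end estimate, see `singleSphereMass_lt_of_kF_lt`.)
[cite: LinEtAl2014SrTiO3Nb, p. 2] [cite: CollignonEtAl2019SrTiO3, §2] [cite: MohrEtAl2025, adjusted-constants table (electron mass)] -/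
theorem lin2014_singleSphere_mass :
    4.20 < singleSphereMass lin2014GammaVol (kF3 2.6e26 1) / electronMassKg ∧
      singleSphereMass lin2014GammaVol (kF3 2.6e26 1) / electronMassKg < 4.21 := by
  obtain ⟨hKlo, hKhi⟩ := lin2014_kF_bounds
  set K := kF3 2.6e26 1 with hKdef
  have hK : 0 < K := by linarith
  have h1 : (3.141592 : ℝ) < π := Real.pi_gt_d6
  have h2 : π < 3.141593 := Real.pi_lt_d6
  have hP : 0 < π ^ 2 := by positivity
  -- the quantity in closed form: 3 h² γ_vol / (4 π² k_B² K m_e)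
  have hform : singleSphereMass lin2014GammaVol K / electronMassKg =
      3 * planckH ^ 2 * lin2014GammaVol / (4 * π ^ 2 * Sommerfeld.kB ^ 2 * K * electronMassKg) := by
    unfold singleSphereMass hbar
    have hπ : (π : ℝ) ≠ 0 := Real.pi_ne_zero
    have hk : Sommerfeld.kB ≠ 0 := by unfold Sommerfeld.kB; norm_num
    have hm : electronMassKg ≠ 0 := by unfold electronMassKg; norm_num
    field_simp
    ring
  rw [hform]
  have hden : 0 < 4 * π ^ 2 * Sommerfeld.kB ^ 2 * K * electronMassKg := by
    unfold Sommerfeld.kB electronMassKg; positivity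
  have hPK_hi : π ^ 2 * K < 3.141593 ^ 2 * 1.9746e9 := by
    have hP_hi : π ^ 2 < 3.141593 ^ 2 := by nlinarith
    exact mul_lt_mul'' hP_hi hKhi hP.le hK.le
  have hPK_lo : 3.141592 ^ 2 * 1.9745e9 < π ^ 2 * K := by
    have hP_lo : (3.141592 : ℝ) ^ 2 < π ^ 2 := by nlinarith
    exact mul_lt_mul'' hP_lo hKlo (by norm_num) (by norm_num)
  unfold lin2014GammaVol srTiO3MolarVolume planckH Sommerfeld.kB Sommerfeld.NA electronMassKg at *
  constructor
  · rw [lt_div_iff₀ hden]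
    nlinarith [hPK_hi]
  · rw [div_lt_iff₀ hden]
    nlinarith [hPK_lo]

end CarrierGas

end Literature.MathematicalPhysics.QuantumManyBody

end
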